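import Literature.Geometry.Riemannian.SphericalCylinderEntropyKernelCalculus
import Literature.Geometry.Riemannian.SphericalCylinderEntropy
import Mathlib.Analysis.Normed.Group.Bounded
import Mathlib.Analysis.Normed.Operator.Basic
import HarnessLib

/-!
# Route `CylinderEntropy`, crux `CylinderRungTwo` (stmt-SmoothPoincare4-7631), line `killing-flux`:
# uniform bounds for the typed kernel and its ambient derivative on a slab of the cylinder
# (registered helper `helper_cylKernelSlabBounds`; lead c4, "relaxation up to multiplicity", worker G)

The typed slice-normalised backward heat kernel of the round cylinder `N = S⁴ × ℝ ⊂ ℝ⁶` centred at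
`y` at scale `τ > 0` is `K_{y,τ}(z) = 𝔥(τ, ⟨z', y'⟩) · e^{-(z₅ - y₅)²/4τ}`
(`SphericalCylinderEntropy.cylKernel`, `cylKernel_eq`), `𝔥(τ, ·) = zonal τ` the Gegenbauer series of
the zonal heat kernel of `S⁴`.  The shift lemma of lead c4 is applied with the test function
`φ = K_{y,τ}` and needs bounds `|φ| ≤ A₀`, `‖Dφ‖ ≤ A₁` at the points `z` of the slab
`N ∩ {|z₅| ≤ B}`, UNIFORM over all centres `y` in the same slab.  This file proves exactly that
(`helper_cylKernelSlabBounds`):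

* for `y, z ∈ N` the argument `s = ⟨z', y'⟩` lies in `[-1, 1]` (`abs_sum_mul_le_one`, Cauchy–Schwarz
  on the base sphere), so `|𝔥(τ, s)| ≤ Z₀` and `|∂_s 𝔥(τ, s)| ≤ Z₁` with the suprema `Z₀, Z₁` of the
  CONTINUOUS functions `zonal τ`, `deriv (zonal τ)` (`hasDerivAt_zonal_tsum`,
  `hasDerivAt_deriv_zonal_tsum`) on the compact interval `[-1, 1]`
  (`IsCompact.exists_bound_of_continuousOn`); the Gaussian factor is `≤ 1`, whence `|K| ≤ A₀ := Z₀`;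
* the first-derivative formula `fderiv_cylKernel_apply`,
  `DK_z(v) = (𝔥'(s) ⟨v', y'⟩ - 𝔥(s) (z₅ - y₅)/(2τ) v₅) e^{-(z₅-y₅)²/4τ}`, together with
  `|⟨v', y'⟩| ≤ ‖v‖`, `|v₅| ≤ ‖v‖` and `|z₅ - y₅| ≤ 2|B|` on the slab gives
  `|DK_z(v)| ≤ (Z₁ + Z₀ |B|/τ) ‖v‖`, i.e. the operator-norm bound `‖DK_z‖ ≤ A₁ := Z₁ + Z₀ |B|/τ`
  (`ContinuousLinearMap.opNorm_le_bound`).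

Everything here is PROVED (no `sorry`, no definitions, no named facts).

References: R. S. Hamilton, *Monotonicity formulas for parabolic flows on manifolds*,
Comm. Anal. Geom. 1 (1993), 127–137, §4 (the kernel); the estimates are elementary calculus.
-/

-- the prescribed namespace `Summit.SmoothPoincare4.SmoothPoincare4.…` repeats `SmoothPoincare4`
set_option linter.dupNamespace false

noncomputable section

open Bundle Set Function Filter MeasureTheory Module
open scoped Manifold ContDiff Topology RealInnerProductSpace BigOperators ENNReal NNReal

namespace Summit.SmoothPoincare4.SmoothPoincare4.Cruxes.CylinderRungTwo.KillingFlux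

open Literature.Geometry.Riemannian
open Literature.Geometry.Riemannian.SphericalCylinderEntropy (cylKernel zonal cylKernel_eq
  abs_sum_mul_le_one fderiv_cylKernel_apply hasDerivAt_zonal_tsum hasDerivAt_deriv_zonal_tsum)

namespace CylKernelSlabBounds

/-! ## Bounds of the zonal factor and of its derivative on `[-1, 1]` -/

/-- Uniform bounds of `𝔥(τ, ·)` and `∂_s 𝔥(τ, ·)` on `[-1, 1]` for `τ > 0`: both are continuous on the
compact interval. [folklore] -/
theorem exists_zonal_bounds {τ : ℝ} (hτ : 0 < τ) :
    ∃ Z₀ Z₁ : ℝ, 0 ≤ Z₀ ∧ 0 ≤ Z₁ ∧ ∀ s : ℝ, |s| ≤ 1 →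
      |zonal τ s| ≤ Z₀ ∧ |deriv (zonal τ) s| ≤ Z₁ := by
  have h0 : Continuous (zonal τ) :=
    continuous_iff_continuousAt.2 fun s => (hasDerivAt_zonal_tsum hτ s).continuousAt
  have h1 : Continuous (deriv (zonal τ)) :=
    continuous_iff_continuousAt.2 fun s => (hasDerivAt_deriv_zonal_tsum hτ s).continuousAt
  obtain ⟨C₀, hC₀⟩ := (isCompact_Icc : IsCompact (Set.Icc (-1 : ℝ) 1)).exists_bound_of_continuousOn
    h0.continuousOn
  obtain ⟨C₁, hC₁⟩ := (isCompact_Icc : IsCompact (Set.Icc (-1 : ℝ) 1)).exists_bound_of_continuousOn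
    h1.continuousOn
  refine ⟨max C₀ 0, max C₁ 0, le_max_right _ _, le_max_right _ _, fun s hs => ?_⟩
  have hs' : s ∈ Set.Icc (-1 : ℝ) 1 := abs_le.1 hs
  refine ⟨?_, ?_⟩
  · have h := hC₀ s hs'
    rw [Real.norm_eq_abs] at h
    exact h.trans (le_max_left _ _)
  · have h := hC₁ s hs'
    rw [Real.norm_eq_abs] at h
    exact h.trans (le_max_left _ _)

/-! ## Two coordinate estimates on `ℝ⁶` -/

/-- `|⟨v', p'⟩| ≤ ‖v‖` for `|p'| = 1` (Cauchy–Schwarz on the first five coordinates). [folklore] -/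
theorem abs_sum_mul_le_norm (v : EuclideanSpace ℝ (Fin 6)) {p : EuclideanSpace ℝ (Fin 6)}
    (hp : ∑ i : Fin 5, p (Fin.castSucc i) ^ 2 = 1) :
    |∑ i : Fin 5, v (Fin.castSucc i) * p (Fin.castSucc i)| ≤ ‖v‖ := by
  refine abs_le_of_sq_le_sq ?_ (norm_nonneg v)
  have h := Finset.sum_mul_sq_le_sq_mul_sq Finset.univ
    (fun i : Fin 5 => v (Fin.castSucc i)) (fun i : Fin 5 => p (Fin.castSucc i))
  simp only [hp, mul_one] at h
  refine h.trans ?_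
  rw [EuclideanSpace.real_norm_sq_eq, Fin.sum_univ_castSucc (f := fun j : Fin 6 => v j ^ 2)]
  linarith [sq_nonneg (v (Fin.last 5))]

/-- `|v₅| ≤ ‖v‖` on `ℝ⁶`. [folklore] -/
theorem abs_apply_five_le_norm (v : EuclideanSpace ℝ (Fin 6)) : |v 5| ≤ ‖v‖ := by
  have h := PiLp.norm_apply_le v (5 : Fin 6)
  rwa [Real.norm_eq_abs] at h

/-- The Gaussian factor `e^{-x²/4τ}` is at most `1` for `τ > 0`. [folklore] -/
theorem gaussFactor_le_one {τ : ℝ} (hτ : 0 < τ) (x : ℝ) : Real.exp (-(x ^ 2) / (4 * τ)) ≤ 1 := by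
  rw [Real.exp_le_one_iff]
  exact div_nonpos_of_nonpos_of_nonneg (neg_nonpos.2 (sq_nonneg x)) (by positivity)

end CylKernelSlabBounds

open CylKernelSlabBounds in
/-- **G: uniform bounds for the typed kernel and its derivative on the compact slab, uniformly in the
centre.**  For `τ > 0` and `B` there are `A₀, A₁ ≥ 0` with `|K_{y,τ}(z)| ≤ A₀` and
`‖D(K_{y,τ})(z)‖ ≤ A₁` for all `y, z ∈ N = S⁴ × ℝ` with `|y₅|, |z₅| ≤ B`
(`A₀ = sup_{[-1,1]} |𝔥(τ, ·)|`, `A₁ = sup_{[-1,1]} |∂_s 𝔥(τ, ·)| + A₀ |B|/τ`). [folklore] -/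
theorem helper_cylKernelSlabBounds : ∀ (B τ : ℝ), 0 < τ → ∃ A₀ A₁ : ℝ, 0 ≤ A₀ ∧ 0 ≤ A₁ ∧ ∀ y z : EuclideanSpace ℝ (Fin 6), ∑ i : Fin 5, y (Fin.castSucc i) ^ 2 = 1 → |y 5| ≤ B → ∑ i : Fin 5, z (Fin.castSucc i) ^ 2 = 1 → |z 5| ≤ B → |Literature.Geometry.Riemannian.SphericalCylinderEntropy.cylKernel y τ z| ≤ A₀ ∧ ‖fderiv ℝ (Literature.Geometry.Riemannian.SphericalCylinderEntropy.cylKernel y τ) z‖ ≤ A₁ := by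
  intro B τ hτ
  obtain ⟨Z₀, Z₁, hZ₀, hZ₁, hZ⟩ := exists_zonal_bounds hτ
  refine ⟨Z₀, Z₁ + Z₀ * (|B| / τ), hZ₀, by positivity, fun y z hy hyB hz hzB => ?_⟩
  obtain ⟨hz0, hz1⟩ := hZ (∑ i : Fin 5, z (Fin.castSucc i) * y (Fin.castSucc i)) (abs_sum_mul_le_one hz hy)
  have hG0 : 0 < Real.exp (-((z 5 - y 5) ^ 2) / (4 * τ)) := Real.exp_pos _
  have hG1 : Real.exp (-((z 5 - y 5) ^ 2) / (4 * τ)) ≤ 1 := gaussFactor_le_one hτ _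
  refine ⟨?_, ?_⟩
  · rw [cylKernel_eq, abs_mul, abs_of_pos hG0]
    calc |zonal τ (∑ i : Fin 5, z (Fin.castSucc i) * y (Fin.castSucc i))| *
          Real.exp (-((z 5 - y 5) ^ 2) / (4 * τ)) ≤ Z₀ * 1 := mul_le_mul hz0 hG1 hG0.le hZ₀
      _ = Z₀ := mul_one _
  · refine ContinuousLinearMap.opNorm_le_bound _ (by positivity) fun v => ?_
    rw [Real.norm_eq_abs, fderiv_cylKernel_apply y hτ z v, abs_mul, abs_of_pos hG0]
    have hv1 : |∑ i : Fin 5, v (Fin.castSucc i) * y (Fin.castSucc i)| ≤ ‖v‖ :=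
      abs_sum_mul_le_norm v hy
    have hv2 : |v 5| ≤ ‖v‖ := abs_apply_five_le_norm v
    have hd : |z 5 - y 5| ≤ 2 * |B| := by
      calc |z 5 - y 5| ≤ |z 5| + |y 5| := abs_sub _ _
        _ ≤ B + B := add_le_add hzB hyB
        _ ≤ 2 * |B| := by linarith [le_abs_self B]
    have hq : |(z 5 - y 5) / (2 * τ)| ≤ |B| / τ := by
      rw [abs_div, abs_of_pos (by positivity : (0 : ℝ) < 2 * τ), ← mul_div_mul_left |B| τ two_ne_zero]
      exact div_le_div_of_nonneg_right hd (by positivity)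
    have hA : |deriv (zonal τ) (∑ i : Fin 5, z (Fin.castSucc i) * y (Fin.castSucc i)) *
        (∑ i : Fin 5, v (Fin.castSucc i) * y (Fin.castSucc i))| ≤ Z₁ * ‖v‖ := by
      rw [abs_mul]
      exact mul_le_mul hz1 hv1 (abs_nonneg _) hZ₁
    have hB : |zonal τ (∑ i : Fin 5, z (Fin.castSucc i) * y (Fin.castSucc i)) *
        ((z 5 - y 5) / (2 * τ)) * v 5| ≤ Z₀ * (|B| / τ) * ‖v‖ := by
      rw [abs_mul, abs_mul]
      exact mul_le_mul (mul_le_mul hz0 hq (abs_nonneg _) hZ₀) hv2 (abs_nonneg _) (by positivity)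
    calc |deriv (zonal τ) (∑ i : Fin 5, z (Fin.castSucc i) * y (Fin.castSucc i)) *
            (∑ i : Fin 5, v (Fin.castSucc i) * y (Fin.castSucc i)) -
          zonal τ (∑ i : Fin 5, z (Fin.castSucc i) * y (Fin.castSucc i)) *
            ((z 5 - y 5) / (2 * τ)) * v 5| * Real.exp (-((z 5 - y 5) ^ 2) / (4 * τ))
        ≤ (Z₁ * ‖v‖ + Z₀ * (|B| / τ) * ‖v‖) * 1 :=
          mul_le_mul ((abs_sub _ _).trans (add_le_add hA hB)) hG1 hG0.le (by positivity)
      _ = (Z₁ + Z₀ * (|B| / τ)) * ‖v‖ := by ring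

end Summit.SmoothPoincare4.SmoothPoincare4.Cruxes.CylinderRungTwo.KillingFlux

end
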